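import Literature.AnabelianGeometry.EtaleTheta.Discharge.Sec4Prop43iHolds
import Literature.AnabelianGeometry.EtaleTheta.Discharge.Sec4Prop43iiiModelHolds
import Literature.AnabelianGeometry.EtaleTheta.Discharge.Sec5BNBaseGaloisLevelN
import HarnessLib

/-!
# [EtTh] Prop 4.3 (i)/(iii) — K4 RE-CLOSE of the cone nodes `EtTh:Prop4.3(i)` / `EtTh:Prop4.3(iii)`: the F-0486 binder
# `IsGalois` FED BY CLOSED PRODUCERS (`A_N` Galois by the root's base-Frobenius-type datum; `B_N` Galois at the §5 data of
# record by the root's base isomorphism) — proof-only, by-name instantiation (Def 4.1 (ii) p.313 / Prop 4.3 pp.316–317, PDF pp.87, 90–91)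

S. Mochizuki, *The étale theta function and its Frobenioid-theoretic manifestations* [EtTh], Publ. RIMS **45** (2009), §4:
Def 4.1 (ii) printed p.313 (PDF p.87) («We shall say that `A` is *Galois* if `A^bs ∈ Ob(D)` is Galois»), Prop 4.2 (iii) p.314
(PDF p.88) («`α` is of base-Frobenius type» — whose datum (a) has `A_N` Galois; «`s'_N, s''_N : A_N → B_N` are base-equivalent
pre-steps» — so `A_N^bs ⥲ B_N^bs`), Prop 4.3 (i)/(iii) pp.316–317 (PDF pp.90–91)
[cite: MochizukiEtTh2009, Def 4.1 (ii) p.313 (PDF p.87); Prop 4.3 (i) p.316 (PDF p.90); Prop 4.3 (iii) p.317 (PDF p.91)].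

Cell abc-iut, layer L2, seat abc-iut-w6-d050 (gen 5), row «K4-RECLOSE M1» of abc-iut-L2-lead (gen 6) R801 (plan C-R33 / K4;
abc-iut-c312-2's CONE-K4-RECLOSE v4 rows `EtTh:Prop4.3(i)` / `EtTh:Prop4.3(iii)`: refuted-closure binder F-0486 `IsGalois`
(the typed §4 root statements carry `(hA : S.IsGalois R.AN) (hB : S.IsGalois R.BN)`; the ∀-closure «every object is Galois» is
refuted at named instances), class RECLOSABLE — all rows have CLOSED producers).  PROOF-ONLY (0 `def`, 0 `instance`, no new
`Prop`); every input BY NAME: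
* §1 (ANY setting `S`) the N-DOMAIN binder `hA` is PRODUCED by the root datum itself — `NthRoot.isGalois_AN := R.αData.isGalois`
  (CONE-FACT-PRODUCERS row 56 `BaseFrobeniusTypeData.isGalois`, 0 Prop binders) — and the node closers re-keyed to it:
  `prop43_iii_of_isGalois_AN` / `prop43_i_of_isGalois_AN` (from the named `Prop43_iii` / `Prop43_i`).  The N-CODOMAIN binder `hB`
  stays a binder at this generality HONESTLY: the abstract field `BiKummerSetting.IsGaloisObj : D → Prop` carries no
  isomorphism-invariance, so `B_N^bs ≅ A_N^bs` does not transport Galois-ness in the bare interface.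
* §2 (THE §5 DATA OF RECORD, abc-iut-L2-t4's `mkOfConnectedTemperoid X tf hZ hP NH A₀ hA₀ hA₀'` over `B^temp(Π^tp_X)⁰`, whose
  Galois objects ARE the temperoid's): `hB` is a THEOREM for EVERY `N`-th root — `NthRoot.isGalois_BN_mkOfConnectedTemperoid`
  (the root's base isomorphism `NthRoot.baseIso` + abc-iut-L2-t1 lineage `GaloisObjects.isGaloisObj_of_iso`; the chain-shape instance
  is abc-iut-w5-d020's `ThetaFrobenioid.isGaloisObj_base_BN`, p-landed) — and BOTH node statements hold there with NO `IsGalois`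
  binder at all: **`prop43_iii_reclosed_mkOfConnectedTemperoid`** (clause 1 of Prop 4.3 (iii) for every bi-Kummer root of every
  `N`-th root, via abc-iut-f-110's `prop43_iii_mkOfModel'` read at `mkOfConnectedTemperoid = mkOfModelCanonical = mkOfModel`,
  recorded as `prop43_iii_mkOfConnectedTemperoid`) and **`prop43_i_reclosed_mkOfConnectedTemperoid`** (Prop 4.3 (i): existence &
  uniqueness of `(s'{}^{gp}, s''{}^{gp})` + `B_N` `H_⊙`-ample, via abc-iut-f-111's `prop43_i_mkOfConnectedTemperoid`); chain-shape
  twins `…_levelN` at the (C)-chain's level-`N` root over the `l`-th root with `hB := isGaloisObj_base_BN R` verbatim.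
K4 / C-R33 reading (evidence `K4-w6d050-RECLOSED.tsv`, abc-iut-c312-2 gen 5 format 18:02:14Z): F-0486 at EtTh:Prop4.3(i)/(iii) is a
PRINTED HYPOTHESIS («A Galois») INHABITED at the data of record — RECLOSED by these siblings, which bind the producers
`BaseFrobeniusTypeData.isGalois` / `isGalois_BN_mkOfConnectedTemperoid` instead of the F-row.  HONEST FRAMING: bookkeeping over landed
theorems; nothing of [EtTh] (refereed) is asserted for an actual curve; F-0486 stays a FACT-policy row (its universal closure is
refuted as typed); no side is taken on [IUTchIII] Cor 3.12; typed ≠ proved.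
-/

noncomputable section

namespace Literature.AnabelianGeometry.EtaleTheta

open CategoryTheory Opposite Literature.AlgebraicGeometry.Frobenioids Literature.AnabelianGeometry.SemiGraphs
  Literature.AnabelianGeometry.SemiGraphs.GaloisObjects

universe u₀ v₀ u v w

variable {K : Type u₀} [Field K]

namespace BiKummerSetting

/-! ## §1. Any setting: the `A_N`-binder is produced by the root datum -/

section Generic

variable {X : SemiGraphs.TemperedArithmeticGroup.{u₀} K} {D₀ : Type u₀} [Category.{v₀} D₀]
  {V : FrdIMonoidStub.{w}} {T : RealifiedDivisorMonoids (D₀ := D₀) V} {D : Type u} [Category.{v} D]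
  {VD : FrdICatStub.{u, v, w} D} {S : BiKummerSetting X T D VD}
  {A B : S.C} {f : S.biratUnits A} {P : S.FractionPair f B} {N : ℕ+}
  {pullFrac : ∀ {A A' : S.C} (_ : A' ⟶ A), S.biratUnits A → S.biratUnits A'}

/-- **The F-0486 head at the `N`-domain is PRODUCED by the root**: `A_N` is Galois — datum (a) of «`α` is of base-Frobenius
type» (Prop 4.2 (iii); CONE-FACT-PRODUCERS producer `BaseFrobeniusTypeData.isGalois`, 0 Prop binders).
[cite: MochizukiEtTh2009, Prop 4.2 (iii) p.314 (PDF p.88)] -/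
theorem NthRoot.isGalois_AN (R : S.NthRoot f P N pullFrac) : S.IsGalois R.AN := R.αData.isGalois

/-- **Prop 4.3 (iii), clause 1, with the `A_N`-binder re-keyed to its producer** (`hA := R.αData.isGalois`); `hB` stays a
binder at this generality (bare `IsGaloisObj`, no isomorphism-invariance in the interface).
[cite: MochizukiEtTh2009, Prop 4.3 (iii) p.317 (PDF p.91)] -/
theorem prop43_iii_of_isGalois_AN (hP : S.Prop43_iii pullFrac) (R : S.NthRoot f P N pullFrac)
    (hB : S.IsGalois R.BN) (Kr : S.BiKummerRoot R R.isGalois_AN hB) (h : S.HA R.BN hB) :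
    Kr.sNum h * (Kr.sDen h)⁻¹ ∈ S.mu R.BN N :=
  hP R R.isGalois_AN hB Kr h

/-- **Prop 4.3 (i) with the `A_N`-binder re-keyed to its producer**: existence & uniqueness of the bi-Kummer pair and
`H_⊙`-ampleness of `B_N`, for trivialising sections over `H_{A_N}` taken at `hA := R.αData.isGalois`.
[cite: MochizukiEtTh2009, Prop 4.3 (i) p.316 (PDF p.90)] -/
theorem prop43_i_of_isGalois_AN (hP : S.Prop43_i pullFrac) (R : S.NthRoot f P N pullFrac) (hB : S.IsGalois R.BN)
    (striv : S.HA R.AN R.isGalois_AN →* Aut R.AN)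
    (hstriv : ∀ h : S.HA R.AN R.isGalois_AN, S.autBase R.AN (striv h) = S.autBase R.AN (h : Aut R.AN))
    (ident : S.HA R.AN R.isGalois_AN ≃* S.HA R.BN hB)
    (hident : ∀ h : S.HA R.AN R.isGalois_AN,
      S.base.map R.pair.num ≫ S.base.map (ident h : Aut R.BN).hom = S.base.map (h : Aut R.AN).hom ≫ S.base.map R.pair.num)
    (hAo : Nonempty (A ≅ S.Aodot)) :
    (∃! q : (S.HA R.BN hB →* Aut R.BN) × (S.HA R.BN hB →* Aut R.BN),
      ∃ Kr : S.BiKummerRoot R R.isGalois_AN hB, Kr.striv = striv ∧ Kr.ident = ident ∧ Kr.sNum = q.1 ∧ Kr.sDen = q.2) ∧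
    S.IsAmple R.BN :=
  hP R R.isGalois_AN hB striv hstriv ident hident hAo

end Generic

/-! ## §2. The §5 data of record `mkOfConnectedTemperoid`: BOTH binders are theorems; the nodes RE-CLOSED -/

section Connected

variable (X : SemiGraphs.TemperedArithmeticGroup.{u₀} K) {D₀ : Type u₀} [Category.{v₀} D₀]
  {V : FrdIMonoidStub.{w}} {T : RealifiedDivisorMonoids (D₀ := D₀) V}
  {VD : FrdICatStub.{u₀ + 1, u₀, w} (ConnectedPart (BTemp X.Pi))}
  (tf : TemperedFrobenioid T (ConnectedPart (BTemp X.Pi)) VD) (hZ : tf.monoidType = MonoidType.Z)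
  (hP : ∀ A : (ConnectedPart (BTemp X.Pi))ᵒᵖ, IsPerfect (tf.Φ.carrier A))
  (NH : Subgroup (Field.absoluteGaloisGroup K) → tf.category → ℕ+ → Prop) (A₀ : tf.category)
  (hA₀ : PreFrobenioid.IsFrobeniusTrivial tf.toElem A₀) (hA₀' : SemiGraphs.IsGaloisObj A₀.base.obj)
  (pullFrac : ∀ {A A' : (mkOfConnectedTemperoid X tf hZ hP NH A₀ hA₀ hA₀').C} (_ : A' ⟶ A),
    (mkOfConnectedTemperoid X tf hZ hP NH A₀ hA₀ hA₀').biratUnits A →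
      (mkOfConnectedTemperoid X tf hZ hP NH A₀ hA₀ hA₀').biratUnits A')

/-- **At the §5 data of record the `B_N`-binder is a THEOREM for every `N`-th root**: `B_N^bs` is a Galois object of
`B^temp(Π^tp_X)` — isomorphic, by the root's base isomorphism `(s'_N)^bs : A_N^bs ⥲ B_N^bs`, to the Galois object `A_N^bs`
(Galois-ness of temperoid objects is iso-invariant).  The (C)-chain's instance is abc-iut-w5-d020's `ThetaFrobenioid.isGaloisObj_base_BN`.
[cite: MochizukiEtTh2009, Def 4.1 (ii) p.313 (PDF p.87); Prop 4.2 (iii) p.314 (PDF p.88)] -/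
theorem NthRoot.isGalois_BN_mkOfConnectedTemperoid {A B : (mkOfConnectedTemperoid X tf hZ hP NH A₀ hA₀ hA₀').C}
    {f : (mkOfConnectedTemperoid X tf hZ hP NH A₀ hA₀ hA₀').biratUnits A}
    {P : (mkOfConnectedTemperoid X tf hZ hP NH A₀ hA₀ hA₀').FractionPair f B} {N : ℕ+}
    (R : (mkOfConnectedTemperoid X tf hZ hP NH A₀ hA₀ hA₀').NthRoot f P N pullFrac) :
    (mkOfConnectedTemperoid X tf hZ hP NH A₀ hA₀ hA₀').IsGalois R.BN :=
  isGaloisObj_of_iso X.isTempered ((connectedObjects (BTemp X.Pi)).ι.mapIso (NthRoot.baseIso _ R)).symm R.αData.isGalois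

/-- **Prop 4.3 (iii) as typed holds at `mkOfConnectedTemperoid` with NO residual hypothesis** (abc-iut-f-110's
`prop43_iii_mkOfModel'` read at `mkOfConnectedTemperoid = mkOfModelCanonical = mkOfModel`; every `pullFrac`, `NH`, `A_⊙`).
[cite: MochizukiEtTh2009, Prop 4.3 (iii) p.317 (PDF p.91)] -/
theorem prop43_iii_mkOfConnectedTemperoid : (mkOfConnectedTemperoid X tf hZ hP NH A₀ hA₀ hA₀').Prop43_iii pullFrac :=
  prop43_iii_mkOfModel' tf hZ hP _ _ _ _ _ NH _ A₀ hA₀ hA₀' pullFrac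

/-- **EtTh:Prop4.3(iii) RE-CLOSED (K4 / C-R33) at the data of record — NO `IsGalois` binder**: for EVERY `N`-th root `R` over
`mkOfConnectedTemperoid` and EVERY bi-Kummer `N`-th root `K` of it (its Galois data being the PRODUCED `R.αData.isGalois`,
`isGalois_BN_mkOfConnectedTemperoid R`), the difference `s'{}^{gp}(h)·s''{}^{gp}(h)⁻¹` lies in `μ_N(B_N)` for every `h ∈ H_{B_N}`.
[cite: MochizukiEtTh2009, Prop 4.3 (iii) p.317 (PDF p.91)] -/
theorem prop43_iii_reclosed_mkOfConnectedTemperoid {A B : (mkOfConnectedTemperoid X tf hZ hP NH A₀ hA₀ hA₀').C}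
    {f : (mkOfConnectedTemperoid X tf hZ hP NH A₀ hA₀ hA₀').biratUnits A}
    {P : (mkOfConnectedTemperoid X tf hZ hP NH A₀ hA₀ hA₀').FractionPair f B} {N : ℕ+}
    (R : (mkOfConnectedTemperoid X tf hZ hP NH A₀ hA₀ hA₀').NthRoot f P N pullFrac)
    (Kr : (mkOfConnectedTemperoid X tf hZ hP NH A₀ hA₀ hA₀').BiKummerRoot R R.isGalois_AN
      (NthRoot.isGalois_BN_mkOfConnectedTemperoid X tf hZ hP NH A₀ hA₀ hA₀' pullFrac R))
    (h : (mkOfConnectedTemperoid X tf hZ hP NH A₀ hA₀ hA₀').HA R.BN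
      (NthRoot.isGalois_BN_mkOfConnectedTemperoid X tf hZ hP NH A₀ hA₀ hA₀' pullFrac R)) :
    Kr.sNum h * (Kr.sDen h)⁻¹ ∈ (mkOfConnectedTemperoid X tf hZ hP NH A₀ hA₀ hA₀').mu R.BN N :=
  prop43_iii_mkOfConnectedTemperoid X tf hZ hP NH A₀ hA₀ hA₀' pullFrac R _ _ Kr h

/-- **EtTh:Prop4.3(i) RE-CLOSED (K4 / C-R33) at the data of record — NO `IsGalois` binder**: for EVERY `N`-th root `R` over
`mkOfConnectedTemperoid` (domain `≅ A_⊙`), every trivialising section over `H_{A_N}` (at the produced `R.αData.isGalois`) and every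
identification over the base, the bi-Kummer pair `(s'{}^{gp}, s''{}^{gp})` exists uniquely AND `B_N` is `H_⊙`-ample (abc-iut-f-111's
`prop43_i_mkOfConnectedTemperoid`, no residual). [cite: MochizukiEtTh2009, Prop 4.3 (i) p.316 (PDF p.90)] -/
theorem prop43_i_reclosed_mkOfConnectedTemperoid {A B : (mkOfConnectedTemperoid X tf hZ hP NH A₀ hA₀ hA₀').C}
    {f : (mkOfConnectedTemperoid X tf hZ hP NH A₀ hA₀ hA₀').biratUnits A}
    {P : (mkOfConnectedTemperoid X tf hZ hP NH A₀ hA₀ hA₀').FractionPair f B} {N : ℕ+}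
    (R : (mkOfConnectedTemperoid X tf hZ hP NH A₀ hA₀ hA₀').NthRoot f P N pullFrac)
    (striv : (mkOfConnectedTemperoid X tf hZ hP NH A₀ hA₀ hA₀').HA R.AN R.isGalois_AN →* Aut R.AN)
    (hstriv : ∀ h : (mkOfConnectedTemperoid X tf hZ hP NH A₀ hA₀ hA₀').HA R.AN R.isGalois_AN,
      (mkOfConnectedTemperoid X tf hZ hP NH A₀ hA₀ hA₀').autBase R.AN (striv h) =
        (mkOfConnectedTemperoid X tf hZ hP NH A₀ hA₀ hA₀').autBase R.AN (h : Aut R.AN))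
    (ident : (mkOfConnectedTemperoid X tf hZ hP NH A₀ hA₀ hA₀').HA R.AN R.isGalois_AN ≃*
      (mkOfConnectedTemperoid X tf hZ hP NH A₀ hA₀ hA₀').HA R.BN
        (NthRoot.isGalois_BN_mkOfConnectedTemperoid X tf hZ hP NH A₀ hA₀ hA₀' pullFrac R))
    (hident : ∀ h : (mkOfConnectedTemperoid X tf hZ hP NH A₀ hA₀ hA₀').HA R.AN R.isGalois_AN,
      (mkOfConnectedTemperoid X tf hZ hP NH A₀ hA₀ hA₀').base.map R.pair.num ≫
          (mkOfConnectedTemperoid X tf hZ hP NH A₀ hA₀ hA₀').base.map (ident h : Aut R.BN).hom =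
        (mkOfConnectedTemperoid X tf hZ hP NH A₀ hA₀ hA₀').base.map (h : Aut R.AN).hom ≫
          (mkOfConnectedTemperoid X tf hZ hP NH A₀ hA₀ hA₀').base.map R.pair.num)
    (hAo : Nonempty (A ≅ (mkOfConnectedTemperoid X tf hZ hP NH A₀ hA₀ hA₀').Aodot)) :
    (∃! q : ((mkOfConnectedTemperoid X tf hZ hP NH A₀ hA₀ hA₀').HA R.BN
          (NthRoot.isGalois_BN_mkOfConnectedTemperoid X tf hZ hP NH A₀ hA₀ hA₀' pullFrac R) →* Aut R.BN) ×
        ((mkOfConnectedTemperoid X tf hZ hP NH A₀ hA₀ hA₀').HA R.BN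
          (NthRoot.isGalois_BN_mkOfConnectedTemperoid X tf hZ hP NH A₀ hA₀ hA₀' pullFrac R) →* Aut R.BN),
      ∃ Kr : (mkOfConnectedTemperoid X tf hZ hP NH A₀ hA₀ hA₀').BiKummerRoot R R.isGalois_AN
          (NthRoot.isGalois_BN_mkOfConnectedTemperoid X tf hZ hP NH A₀ hA₀ hA₀' pullFrac R),
        Kr.striv = striv ∧ Kr.ident = ident ∧ Kr.sNum = q.1 ∧ Kr.sDen = q.2) ∧
    (mkOfConnectedTemperoid X tf hZ hP NH A₀ hA₀ hA₀').IsAmple R.BN :=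
  prop43_i_mkOfConnectedTemperoid X tf hZ hP NH A₀ hA₀ hA₀' pullFrac R _ _ striv hstriv ident hident hAo

end Connected

/-! ## §3. The (C)-chain's shape: the level-`N` root over the `l`-th root, `hB` = abc-iut-w5-d020's lemma verbatim -/

section LevelN

variable {X : SemiGraphs.TemperedArithmeticGroup.{u₀} K} {D₀ : Type u₀} [Category.{v₀} D₀]
  {V : FrdIMonoidStub.{w}} {T₀ : RealifiedDivisorMonoids (D₀ := D₀) V}
  {VD : FrdICatStub.{u₀ + 1, u₀, w} (ConnectedPart (BTemp X.Pi))}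
  {tf : TemperedFrobenioid T₀ (ConnectedPart (BTemp X.Pi)) VD} {hZ : tf.monoidType = MonoidType.Z}
  {hP : ∀ A : (ConnectedPart (BTemp X.Pi))ᵒᵖ, IsPerfect (tf.Φ.carrier A)}
  {NH : Subgroup (Field.absoluteGaloisGroup K) → tf.category → ℕ+ → Prop} {A₀ : tf.category}
  {hA₀ : PreFrobenioid.IsFrobeniusTrivial tf.toElem A₀} {hA₀' : SemiGraphs.IsGaloisObj A₀.base.obj}
  {pullFrac : ∀ {A A' : (BiKummerSetting.mkOfConnectedTemperoid X tf hZ hP NH A₀ hA₀ hA₀').C} (_ : A' ⟶ A),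
    (BiKummerSetting.mkOfConnectedTemperoid X tf hZ hP NH A₀ hA₀ hA₀').biratUnits A →
      (BiKummerSetting.mkOfConnectedTemperoid X tf hZ hP NH A₀ hA₀ hA₀').biratUnits A'}
  {lv : ℕ+}
  {θ : (BiKummerSetting.mkOfConnectedTemperoid X tf hZ hP NH A₀ hA₀ hA₀').biratUnits
    (BiKummerSetting.mkOfConnectedTemperoid X tf hZ hP NH A₀ hA₀ hA₀').Aodot}
  {Bl : (BiKummerSetting.mkOfConnectedTemperoid X tf hZ hP NH A₀ hA₀ hA₀').C}
  {Pl : (BiKummerSetting.mkOfConnectedTemperoid X tf hZ hP NH A₀ hA₀ hA₀').FractionPair θ Bl}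
  {Rl : (BiKummerSetting.mkOfConnectedTemperoid X tf hZ hP NH A₀ hA₀ hA₀').NthRoot θ Pl lv pullFrac}
  {N : ℕ+} (R : (BiKummerSetting.mkOfConnectedTemperoid X tf hZ hP NH A₀ hA₀ hA₀').NthRoot Rl.root Rl.pair N pullFrac)

/-- **EtTh:Prop4.3(iii) RE-CLOSED at the (C)-chain's level-`N` root** (over the `l`-th root of `Θ̈`, as in the Thm 5.6/5.7 knit),
with `hB := ThetaFrobenioid.isGaloisObj_base_BN R` (abc-iut-w5-d020) verbatim. [cite: MochizukiEtTh2009, Prop 4.3 (iii) p.317 (PDF p.91)] -/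
theorem prop43_iii_reclosed_levelN
    (Kr : (BiKummerSetting.mkOfConnectedTemperoid X tf hZ hP NH A₀ hA₀ hA₀').BiKummerRoot R R.isGalois_AN
      (ThetaFrobenioid.isGaloisObj_base_BN R))
    (h : (BiKummerSetting.mkOfConnectedTemperoid X tf hZ hP NH A₀ hA₀ hA₀').HA R.BN (ThetaFrobenioid.isGaloisObj_base_BN R)) :
    Kr.sNum h * (Kr.sDen h)⁻¹ ∈ (BiKummerSetting.mkOfConnectedTemperoid X tf hZ hP NH A₀ hA₀ hA₀').mu R.BN N :=
  prop43_iii_mkOfConnectedTemperoid X tf hZ hP NH A₀ hA₀ hA₀' pullFrac R _ _ Kr h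

/-- **EtTh:Prop4.3(i) RE-CLOSED at the (C)-chain's level-`N` root**: `B_N` is `H_⊙`-ample and the bi-Kummer pair exists uniquely,
with `hA := R.αData.isGalois`, `hB := ThetaFrobenioid.isGaloisObj_base_BN R` — NO `IsGalois` binder; print's «domain isomorphic
to `A_⊙`» hypothesis of Prop 4.3 (i) is kept verbatim (`hAo`, for the level-`N` root's domain `A_l`).
[cite: MochizukiEtTh2009, Prop 4.3 (i) p.316 (PDF p.90)] -/
theorem isAmple_BN_levelN
    (hAo : Nonempty (Rl.AN ≅ (BiKummerSetting.mkOfConnectedTemperoid X tf hZ hP NH A₀ hA₀ hA₀').Aodot))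
    (striv : (BiKummerSetting.mkOfConnectedTemperoid X tf hZ hP NH A₀ hA₀ hA₀').HA R.AN R.isGalois_AN →* Aut R.AN)
    (hstriv : ∀ h : (BiKummerSetting.mkOfConnectedTemperoid X tf hZ hP NH A₀ hA₀ hA₀').HA R.AN R.isGalois_AN,
      (BiKummerSetting.mkOfConnectedTemperoid X tf hZ hP NH A₀ hA₀ hA₀').autBase R.AN (striv h) =
        (BiKummerSetting.mkOfConnectedTemperoid X tf hZ hP NH A₀ hA₀ hA₀').autBase R.AN (h : Aut R.AN))
    (ident : (BiKummerSetting.mkOfConnectedTemperoid X tf hZ hP NH A₀ hA₀ hA₀').HA R.AN R.isGalois_AN ≃*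
      (BiKummerSetting.mkOfConnectedTemperoid X tf hZ hP NH A₀ hA₀ hA₀').HA R.BN (ThetaFrobenioid.isGaloisObj_base_BN R))
    (hident : ∀ h : (BiKummerSetting.mkOfConnectedTemperoid X tf hZ hP NH A₀ hA₀ hA₀').HA R.AN R.isGalois_AN,
      (BiKummerSetting.mkOfConnectedTemperoid X tf hZ hP NH A₀ hA₀ hA₀').base.map R.pair.num ≫
          (BiKummerSetting.mkOfConnectedTemperoid X tf hZ hP NH A₀ hA₀ hA₀').base.map (ident h : Aut R.BN).hom =
        (BiKummerSetting.mkOfConnectedTemperoid X tf hZ hP NH A₀ hA₀ hA₀').base.map (h : Aut R.AN).hom ≫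
          (BiKummerSetting.mkOfConnectedTemperoid X tf hZ hP NH A₀ hA₀ hA₀').base.map R.pair.num) :
    (BiKummerSetting.mkOfConnectedTemperoid X tf hZ hP NH A₀ hA₀ hA₀').IsAmple R.BN :=
  (prop43_i_reclosed_mkOfConnectedTemperoid X tf hZ hP NH A₀ hA₀ hA₀' pullFrac R striv hstriv ident hident hAo).2

end LevelN

end BiKummerSetting

end Literature.AnabelianGeometry.EtaleTheta

end
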